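import Mathlib
import HarnessLib
import Summits.KontsevichZagierPeriods.KontsevichZagierPeriods.Theorems.FurushoPentagonKernelModuloPeriodConjectureShuffleDepthOne
import Summits.KontsevichZagierPeriods.KontsevichZagierPeriods.Theorems.FurushoPentagonKernelModuloPeriodConjectureEulerRecursion
import Summits.KontsevichZagierPeriods.KontsevichZagierPeriods.Theorems.FurushoPentagonKernelModuloPeriodConjectureNewtonPiY
import Summits.KontsevichZagierPeriods.KontsevichZagierPeriods.Theorems.FurushoPentagonKernelModuloPeriodConjectureEvenDepthOneLeaf

/-!
# `KernelModuloPeriodConjecture`, line `Sketch`: power forms for `π_Y(φ)({2c}ʲ)`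

Crux `FurushoPentagon.KernelModuloPeriodConjecture` (stmt-KontsevichZagierPeriods-15058), line
`Sketch`, registered stub `stub_powerFormReplicate` (stub (vi) of the lead's skeleton): for every
`c ≥ 1` and every `N`, universal rationals `q_j` (`j ≤ N`) with

  `π_Y(φ)({2c}ʲ) = q_j · c_{(2)}(φ)^{c j}`

at every group-like solution `φ` of Drinfeld's pentagon equation over every commutative `ℚ`-algebra
(at `Φ_KZ`: `ζ(2c, …, 2c) ∈ ℚ π^{2cj}`, Hoffman 1992, Theorem 2.2). The proof is the induction on
Newton's identity in Hoffman's harmonic algebra on the single letter `y_{2c}` (landed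
`stub_newtonPiY`), fed with Euler's theorem for associators in power form
`c_{(2j)}(φ) = a_j c_{(2)}(φ)ʲ` (landed `evenLeaf_exists_depthOne`, from `stub_eulerRecursion` and
`stub_shuffleDepthOne`); it copies `evenLeaf_piY_replicate_step` / `evenLeaf_exists_piY_replicate_upto`
(the case `c = 1`), only the letter `2 ↦ 2c` and the exponent `j ↦ c j` change.

References: M. E. Hoffman, *Multiple harmonic series*, Pacific J. Math. 152 (1992), Thm 2.2
[Hoffman1992]; M. E. Hoffman, *The algebra of multiple harmonic series*, J. Algebra 194 (1997), §2
[Hoffman1997]; H. Furusho, *Double shuffle relation for associators*, Ann. of Math. 174 (2011), §5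
[Furusho2011]; K. Ihara, M. Kaneko, D. Zagier, *Derivation and double shuffle relations for multiple
zeta values*, Compos. Math. 142 (2006), §2 [IharaKanekoZagier2006].
-/

namespace Summit.KontsevichZagierPeriods.FurushoPentagon.KernelModuloPeriodConjecture

open Literature.NumberTheory.Transcendental

/-- **Newton's identity on the letter `y_{2c}`, solved one step.** If `c_{(2j)}(φ) = a_j c_{(2)}(φ)ʲ`
(`j ≥ 1`) and `π_Y(φ)({2c}ʲ) = q_j c_{(2)}(φ)^{cj}` (`j ≤ N`) at every group-like pentagon solution,
then Newton's identity for `π_Y(φ)` (landed `stub_newtonPiY` at `m = 2c`) gives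
`π_Y(φ)({2c}^{N+1}) = q_{N+1} c_{(2)}(φ)^{c(N+1)}` with the universal rational
`q_{N+1} = (N+1)⁻¹ Σ_{k=0}^{N} (-1)ᵏ (-a_{c(k+1)}) q_{N-k}` (`π_Y(φ)(y_{2c(k+1)}) = -c_{(2c(k+1))}(φ)`).
[cite: Hoffman1992, Theorem 2.2] -/
theorem powerFormRep_step {c : ℕ} (hc : 1 ≤ c) (a q : ℕ → ℚ)
    (ha : ∀ j : ℕ, 1 ≤ j → ∀ (R : Type) [CommRing R] [Algebra ℚ R] (φ : NCSeries Bool R),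
      NCSeries.IsGroupLike φ → NCSeries.DrinfeldPentagon φ →
        φ (MZV.binaryWord [2 * j]) = algebraMap ℚ R (a j) * φ (MZV.binaryWord [2]) ^ j)
    {N : ℕ}
    (hq : ∀ j : ℕ, j ≤ N → ∀ (R : Type) [CommRing R] [Algebra ℚ R] (φ : NCSeries Bool R),
      NCSeries.IsGroupLike φ → NCSeries.DrinfeldPentagon φ →
        NCSeries.piY φ (List.replicate j (2 * c)) =
          algebraMap ℚ R (q j) * φ (MZV.binaryWord [2]) ^ (c * j))
    (R : Type) [CommRing R] [Algebra ℚ R] (φ : NCSeries Bool R) (hg : NCSeries.IsGroupLike φ)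
    (h5 : NCSeries.DrinfeldPentagon φ) :
    NCSeries.piY φ (List.replicate (N + 1) (2 * c)) =
      algebraMap ℚ R (((N + 1 : ℕ) : ℚ)⁻¹ *
          ∑ k ∈ Finset.range (N + 1), (-1) ^ k * (-a (c * (k + 1)) * q (N - k))) *
        φ (MZV.binaryWord [2]) ^ (c * (N + 1)) := by
  have key := stub_newtonPiY R φ hg h5 (2 * c) (by omega) N
  have hsum : ∑ k ∈ Finset.range (N + 1), (-1) ^ k *
        (NCSeries.piY φ [(k + 1) * (2 * c)] * NCSeries.piY φ (List.replicate (N - k) (2 * c))) =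
      algebraMap ℚ R (∑ k ∈ Finset.range (N + 1), (-1) ^ k * (-a (c * (k + 1)) * q (N - k))) *
        φ (MZV.binaryWord [2]) ^ (c * (N + 1)) := by
    rw [map_sum, Finset.sum_mul]
    refine Finset.sum_congr rfl fun k hk => ?_
    rw [Finset.mem_range] at hk
    obtain ⟨i, rfl⟩ : ∃ i, N = k + i := ⟨N - k, by omega⟩
    have h1 : 1 ≤ (k + 1) * (2 * c) := Nat.mul_pos k.succ_pos (by omega)
    have h2 : 1 ≤ c * (k + 1) := Nat.mul_pos (by omega) k.succ_pos
    rw [Nat.add_sub_cancel_left, NCSeries.piY_apply_singleton φ h1,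
      show (k + 1) * (2 * c) = 2 * (c * (k + 1)) by ring,
      ha (c * (k + 1)) h2 R φ hg h5, hq i (by omega) R φ hg h5, map_mul, map_mul, map_neg,
      map_pow, map_neg, map_one, show c * (k + i + 1) = c * (k + 1) + c * i by ring, pow_add]
    ring
  have hcast : ((N : R) + 1) = algebraMap ℚ R ((N + 1 : ℕ) : ℚ) := by
    rw [map_natCast]
    norm_cast
  rw [hsum, hcast] at key
  have hd : ((N + 1 : ℕ) : ℚ) ≠ 0 := by positivity
  rw [evenLeaf_eq_inv_mul hd key, ← mul_assoc, ← map_mul]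

/-- **`π_Y(φ)({2c}ʲ) ∈ ℚ c_{(2)}(φ)^{cj}` uniformly, up to `N`**: given universal rationals `a_j`
with `c_{(2j)}(φ) = a_j c_{(2)}(φ)ʲ` (`j ≥ 1`), universal rationals `q_j` with
`π_Y(φ)({2c}ʲ) = q_j c_{(2)}(φ)^{cj}` for `j ≤ N` at every group-like pentagon solution over every
commutative `ℚ`-algebra (`q_0 = 1` as `π_Y(φ)(∅) = c_∅(φ) = 1`; induction on Newton's identity on the
letter `y_{2c}`). At `Φ_KZ`: `ζ({2c}ʲ) ∈ ℚ ζ(2)^{cj}` (Hoffman). [cite: Hoffman1992, Theorem 2.2] -/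
theorem powerFormRep_upto {c : ℕ} (hc : 1 ≤ c) (a : ℕ → ℚ)
    (ha : ∀ j : ℕ, 1 ≤ j → ∀ (R : Type) [CommRing R] [Algebra ℚ R] (φ : NCSeries Bool R),
      NCSeries.IsGroupLike φ → NCSeries.DrinfeldPentagon φ →
        φ (MZV.binaryWord [2 * j]) = algebraMap ℚ R (a j) * φ (MZV.binaryWord [2]) ^ j)
    (N : ℕ) :
    ∃ q : ℕ → ℚ, ∀ j : ℕ, j ≤ N →
      ∀ (R : Type) [CommRing R] [Algebra ℚ R] (φ : NCSeries Bool R),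
        NCSeries.IsGroupLike φ → NCSeries.DrinfeldPentagon φ →
          NCSeries.piY φ (List.replicate j (2 * c)) =
            algebraMap ℚ R (q j) * φ (MZV.binaryWord [2]) ^ (c * j) := by
  induction N with
  | zero =>
    refine ⟨fun _ => 1, fun j hj R _ _ φ hg _ => ?_⟩
    obtain rfl : j = 0 := Nat.le_zero.mp hj
    simp [hg.apply_nil]
  | succ N ih =>
    obtain ⟨q, hq⟩ := ih
    refine ⟨Function.update q (N + 1)
        (((N + 1 : ℕ) : ℚ)⁻¹ *
          ∑ k ∈ Finset.range (N + 1), (-1) ^ k * (-a (c * (k + 1)) * q (N - k))),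
      fun j hj R _ _ φ hg h5 => ?_⟩
    rcases Nat.lt_or_ge j (N + 1) with hlt | hge
    · rw [Function.update_of_ne (Nat.ne_of_lt hlt)]
      exact hq j (by omega) R φ hg h5
    · obtain rfl : j = N + 1 := by omega
      rw [Function.update_self]
      exact powerFormRep_step hc a q ha hq R φ hg h5

/-- **Registered stub `stub_powerFormReplicate`** (stub (vi) of the lead's skeleton, crux
stmt-KontsevichZagierPeriods-15058, line `Sketch`), verbatim: for every `c ≥ 1` and every `N`,
universal rationals `q_j` with `π_Y(φ)({2c}ʲ) = q_j c_{(2)}(φ)^{cj}` for all `j ≤ N` at every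
group-like solution of Drinfeld's pentagon equation over every commutative `ℚ`-algebra — Newton's
identity for `π_Y(φ)` on the letter `y_{2c}` (landed `stub_newtonPiY`) fed with Euler's theorem for
associators in power form (landed `evenLeaf_exists_depthOne` ← `stub_eulerRecursion` ←
`stub_shuffleDepthOne`). At `Φ_KZ`: `ζ(2c, …, 2c) ∈ ℚ ζ(2)^{cj}` (Hoffman 1992, Theorem 2.2).
[cite: Hoffman1992, Theorem 2.2] -/
theorem stub_powerFormReplicate :
    ∀ c : ℕ, 1 ≤ c → ∀ N : ℕ, ∃ q : ℕ → ℚ, ∀ j : ℕ, j ≤ N →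
      ∀ (R : Type) [CommRing R] [Algebra ℚ R] (φ : NCSeries Bool R),
        NCSeries.IsGroupLike φ → NCSeries.DrinfeldPentagon φ →
          NCSeries.piY φ (List.replicate j (2 * c)) =
            algebraMap ℚ R (q j) * φ (MZV.binaryWord [2]) ^ (c * j) := by
  intro c hc N
  -- Euler's recursion (landed stub (ii)) with its depth-one shuffle input (landed stub (i)) supplied
  have hEu : ∀ (R : Type) [CommRing R] [Algebra ℚ R] (φ : NCSeries Bool R),
      NCSeries.IsGroupLike φ → NCSeries.DrinfeldPentagon φ → ∀ n : ℕ, 2 ≤ n →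
        (2 * n + 1 : R) * φ (MZV.binaryWord [2 * n]) =
          -2 * ∑ j ∈ Finset.Ico 1 n,
            φ (MZV.binaryWord [2 * j]) * φ (MZV.binaryWord [2 * (n - j)]) :=
    fun R _ _ φ hg h5 => stub_eulerRecursion R φ hg h5 (stub_shuffleDepthOne R φ hg)
  obtain ⟨a, ha⟩ := evenLeaf_exists_depthOne hEu
  exact powerFormRep_upto hc a ha N

end Summit.KontsevichZagierPeriods.FurushoPentagon.KernelModuloPeriodConjecture
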